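import Mathlib
import Summits.KontsevichZagierPeriods.Zeta5Search.Families.DualQPolynomial
import Summits.KontsevichZagierPeriods.Zeta5Search.Families.DualSpanProdCoeff
import Summits.KontsevichZagierPeriods.Zeta5Search.Certificates.BinomialSumBounds
import Summits.KontsevichZagierPeriods.Zeta5Search.WedgeDictionaryVanishing
import Literature.NumberTheory.Irrationality.BrownZudilin2022.GeneralFamily
import HarnessLib

/-!
# ζ(5) search — Families: Brown–Zudilin's leading coefficient (17) IS a polynomial coefficient — the bridge
# `|Q(p;q)| = G(e,t)` (twelve parameters) and `|Q(a)| = G(e(a), t(a))` on the cone of CONJECTURE D-exact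

HONEST FRAMING: systematic search; no irrationality claim unless certified.  Cell `pub-zeta5`, certifier 2
(cert-2 g8, 2026-08-22).  An identity between two finite sums of products of binomial coefficients; no conjecture node
is used; nothing about `ζ(5)`; no number of record moves.

WHAT.  `Families/DualQPolynomial` (p312738) defined `G(e,t) = [z^{t₁} z'^{t₂} v^{t₃} y^{t₄} y'^{t₅}] (1+v)^{e₁}(1+z)^{e₂}
(1+z')^{e₃}(1+y)^{e₄}(1+y')^{e₅}(1+y(1+z)(1+v))^{e₆}(1+y'(1+z')(1+v))^{e₇}`.  Here we PROVE that Brown–Zudilin's leading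
coefficient [BrownZudilin2022, Sect. 5, (17)] (tree: `BrownZudilin2022.Qcoeff`, an alternating-sign-free double binomial sum
times `(−1)^{Σp}`) satisfies
  **`|Q(p;q)| = G(e(p,q), t(p,q))`**,  `e = (q₃−p₀−p₆+p₂+p₄, p₂, p₄, q₁, q₅, q₂, q₄)`,
  `t = (p₀, p₆, p₃+q₃−p₀−p₆, q₁+p₁−p₂, q₅+p₅−p₄)`   (`abs_Qcoeff_eq_G`)
for every `(p;q) ∈ ℤ¹²` with `p₂, p₄ ≥ 0`, `q ≥ 0` and `q₃−p₀−p₆+p₂+p₄ ≥ 0` (`t` may have negative entries — then both sides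
vanish), and hence **`|Q(a)| = G(e(a), t(a))` for every `a` with `bzNum a ≥ 0` and `h₂₇(a) ≥ 0`** (the part of the cone
of P2 g6's CONJECTURE D-exact inside Brown–Zudilin's half-space `h₂₇ ≥ 0`, which contains the whole convergent cone)
(`abs_QOf_eq_G`; `e(a) = (a₃+a₆+2a₇−a₁−a₂−a₅, a₅, a₆, a₃, a₁, a₄, a₀)`, `t(a) = (B₇, B₃, a₃−a₅+a₇, B₅, B₁)`, 0-based `a`,
`B = bzDen a`).  Mechanism: expand the two cubic factors by the binomial theorem (`i = k₁ − p₂`, `j = k₂ − p₄`); the five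
remaining extractions are independent and give the seven binomials of (17) term by term (`C(q₁, t₄ − i) = C(q₁, k₁ − p₁)` by
symmetry; `C(e₁+i+j, t₃)` is the coupling binomial).  Reuses `BinomialSum.zchoose_nonneg`, `WedgeDictionary.zchoose_eq_zero`; coefficient extraction uses cert-2 g7's `DualCT.coeff_X_add_pow_mul` /
`coeff_X_pow_mul_X_add_pow_mul` (`Families/DualSpanProdCoeff`).
-/

noncomputable section

open MvPolynomial Finset

namespace Summit.KontsevichZagierPeriods.Zeta5Search.Families.Cellular

namespace DualQ

open Literature.NumberTheory.Irrationality
open Literature.NumberTheory.Irrationality.BrownZudilin2022 (zchoose Qcoeff QOf pOf qOf)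
open Summit.KontsevichZagierPeriods.Zeta5Search.BinomialSum (zchoose_nonneg)
open Summit.KontsevichZagierPeriods.Zeta5Search.WedgeDictionary (zchoose_eq_zero)
open DualCT (notMem_vars_mul notMem_vars_pow_and notMem_vars_add notMem_vars_X_and coeff_X_add_pow_mul
  coeff_X_pow_mul_X_add_pow_mul)

/-! ## Integer binomials -/

/-- `zchoose N K = C(N, K)` on naturals for `N, K ≥ 0` (both sides vanish when `K > N`). -/
theorem zchoose_of_nonneg {N K : ℤ} (hN : 0 ≤ N) (hK : 0 ≤ K) : zchoose N K = (N.toNat.choose K.toNat : ℤ) := by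
  unfold zchoose
  split_ifs with h
  · rfl
  · rw [Nat.choose_eq_zero_of_lt (by omega)]; simp

/-- The flipped binomial: for `q ≥ 0` and `M = q + p₁ − p₂ ≥ 0`,
`C(q, k₁ − p₁)` at `k₁ = p₂ + i` equals the guarded `C(q, M − i)`. -/
theorem zchoose_flip {q p₁ p₂ : ℤ} (hq : 0 ≤ q) {M : ℤ} (hM : M = q + p₁ - p₂) (hM0 : 0 ≤ M) (i : ℕ) :
    zchoose q (p₂ + i - p₁) = if i ≤ M.toNat then (q.toNat.choose (M.toNat - i) : ℤ) else 0 := by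
  split_ifs with hi
  · by_cases hneg : p₂ + i - p₁ < 0
    · rw [zchoose_eq_zero (Or.inl hneg), Nat.choose_eq_zero_of_lt (by omega)]; simp
    · rw [zchoose_of_nonneg hq (by omega)]
      have h1 : (p₂ + ↑i - p₁).toNat ≤ q.toNat := by omega
      rw [← Nat.choose_symm h1]
      congr 2; omega
  · exact zchoose_eq_zero (Or.inr (by omega))

/-! ## Sums over integer intervals -/

/-- `Σ_{k ∈ [a, a+n]} f(k) = Σ_{i < n+1} f(a + i)`. -/
theorem sum_Icc_eq_sum_range (a : ℤ) (n : ℕ) (f : ℤ → ℤ) :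
    ∑ k ∈ Icc a (a + n), f k = ∑ i ∈ range (n + 1), f (a + i) := by
  have himg : Icc a (a + n) = (range (n + 1)).image fun i : ℕ => a + i := by
    ext k
    simp only [mem_Icc, mem_image, mem_range]
    constructor
    · rintro ⟨h1, h2⟩; exact ⟨(k - a).toNat, by omega, by omega⟩
    · rintro ⟨i, hi, rfl⟩; constructor <;> omega
  rw [himg, sum_image]
  intro x _ y _ h; simpa using h

/-- Restricting a sum to where the summand can be non-zero (both ranges contain the support). -/
theorem sum_eq_of_support {S S' : Finset ℤ} {f : ℤ → ℤ} (h : ∀ x ∈ S, x ∉ S' → f x = 0)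
    (h' : ∀ x ∈ S', x ∉ S → f x = 0) : ∑ x ∈ S, f x = ∑ x ∈ S', f x := by
  have e1 : ∑ x ∈ S, f x = ∑ x ∈ S ∪ S', f x :=
    Finset.sum_subset Finset.subset_union_left fun x hx hxS => by
      rcases Finset.mem_union.1 hx with hS | hS'
      · exact absurd hS hxS
      · exact h' x hS' hxS
  have e2 : ∑ x ∈ S', f x = ∑ x ∈ S ∪ S', f x :=
    Finset.sum_subset Finset.subset_union_right fun x hx hxS' => by
      rcases Finset.mem_union.1 hx with hS | hS'
      · exact h x hS hxS'
      · exact absurd hS' hxS'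
  rw [e1, e2]

/-! ## The (17) side -/

/-- The unsigned summand of (17). -/
def bzTerm (p : Fin 7 → ℤ) (q : Fin 5 → ℤ) (k₁ k₂ : ℤ) : ℤ :=
  zchoose k₁ (p 0) * zchoose k₂ (p 6) * zchoose (k₁ + k₂ + q 2 - p 0 - p 6) (p 3 + q 2 - p 0 - p 6) *
    zchoose (q 0) (k₁ - p 1) * zchoose (q 1) (k₁ - p 2) * zchoose (q 3) (k₂ - p 4) * zchoose (q 4) (k₂ - p 5)

/-- `|Q(p;q)|` is the double sum of the unsigned summands. -/
theorem abs_Qcoeff (p : Fin 7 → ℤ) (q : Fin 5 → ℤ) :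
    |Qcoeff p q| = ∑ k₁ ∈ Icc (p 1) (p 1 + q 0), ∑ k₂ ∈ Icc (p 4) (p 4 + q 3), bzTerm p q k₁ k₂ := by
  have h0 : 0 ≤ ∑ k₁ ∈ Icc (p 1) (p 1 + q 0), ∑ k₂ ∈ Icc (p 4) (p 4 + q 3), bzTerm p q k₁ k₂ :=
    sum_nonneg fun _ _ => sum_nonneg fun _ _ => by
      unfold bzTerm
      have z := zchoose_nonneg
      exact mul_nonneg (mul_nonneg (mul_nonneg (mul_nonneg (mul_nonneg (mul_nonneg (z _ _) (z _ _)) (z _ _))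
        (z _ _)) (z _ _)) (z _ _)) (z _ _)
  change |(-1) ^ (∑ i, p i).toNat * ∑ k₁ ∈ Icc (p 1) (p 1 + q 0), ∑ k₂ ∈ Icc (p 4) (p 4 + q 3), bzTerm p q k₁ k₂| = _
  rw [abs_mul, abs_pow, abs_neg, abs_one, one_pow, one_mul, abs_of_nonneg h0]

/-! ## The dictionary `(p;q) ↦ (e,t)` -/

/-- `e(p,q) = (q₃−p₀−p₆+p₂+p₄, p₂, p₄, q₁, q₅, q₂, q₄)` (as naturals). -/
def eOfPQ (p : Fin 7 → ℤ) (q : Fin 5 → ℤ) : Fin 7 → ℕ :=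
  ![(q 2 - p 0 - p 6 + p 2 + p 4).toNat, (p 2).toNat, (p 4).toNat, (q 0).toNat, (q 4).toNat, (q 1).toNat, (q 3).toNat]

/-- `t(p,q) = (p₀, p₆, p₃+q₃−p₀−p₆, q₁+p₁−p₂, q₅+p₅−p₄)`. -/
def tOfPQ (p : Fin 7 → ℤ) (q : Fin 5 → ℤ) : Fin 5 → ℤ :=
  ![p 0, p 6, p 3 + q 2 - p 0 - p 6, q 0 + p 1 - p 2, q 4 + p 5 - p 4]

/-! ## The polynomial side: expanding `qPoly` -/

/-- The `(i,j)` term after expanding the two cubic factors, in extraction order `y, y', z, z', v`. -/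
def termIJ (e₁ p₂ p₄ q₁ q₅ : ℕ) (i j : ℕ) : P5 :=
  X 3 ^ i * ((X 3 + 1) ^ q₁ * (X 4 ^ j * ((X 4 + 1) ^ q₅ *
    ((X 0 + 1) ^ (p₂ + i) * ((X 1 + 1) ^ (p₄ + j) * (X 2 + 1) ^ (e₁ + i + j))))))

/-- `qPoly e = Σ_{i ≤ e₆} Σ_{j ≤ e₇} C(e₆,i) C(e₇,j) · termIJ`. -/
theorem qPoly_eq_sum (e : Fin 7 → ℕ) :
    qPoly e = ∑ i ∈ range (e 5 + 1), ∑ j ∈ range (e 6 + 1),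
      C (((e 5).choose i * (e 6).choose j : ℕ) : ℤ) * termIJ (e 0) (e 1) (e 2) (e 3) (e 4) i j := by
  have h5 : qFactor 5 ^ e 5 = ∑ i ∈ range (e 5 + 1),
      (X 3 * (1 + X 0) * (1 + X 2)) ^ i * (1 : P5) ^ (e 5 - i) * ((e 5).choose i : P5) := by
    rw [show qFactor 5 = X 3 * (1 + X 0) * (1 + X 2) + 1 from by simp [qFactor]; ring, add_pow]
  have h6 : qFactor 6 ^ e 6 = ∑ j ∈ range (e 6 + 1),
      (X 4 * (1 + X 1) * (1 + X 2)) ^ j * (1 : P5) ^ (e 6 - j) * ((e 6).choose j : P5) := by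
    rw [show qFactor 6 = X 4 * (1 + X 1) * (1 + X 2) + 1 from by simp [qFactor]; ring, add_pow]
  unfold qPoly
  rw [h5, h6, show qFactor 0 = 1 + X 2 by rfl, show qFactor 1 = 1 + X 0 by rfl, show qFactor 2 = 1 + X 1 by rfl,
    show qFactor 3 = 1 + X 3 by rfl, show qFactor 4 = 1 + X 4 by rfl]
  simp only [one_pow, mul_one]
  rw [mul_assoc, Finset.sum_mul_sum]
  simp only [Finset.mul_sum]
  refine Finset.sum_congr rfl fun i _ => Finset.sum_congr rfl fun j _ => ?_
  unfold termIJ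
  simp only [← C_eq_coe_nat, Nat.cast_mul, map_mul, mul_pow]
  ring

/-- The coefficient of `x^m` in `termIJ`: five independent binomials (two guards). -/
theorem coeff_termIJ (e₁ p₂ p₄ q₁ q₅ i j : ℕ) (m : Fin 5 →₀ ℕ) :
    coeff m (termIJ e₁ p₂ p₄ q₁ q₅ i j) =
      (if i ≤ m 3 then (q₁.choose (m 3 - i) : ℤ) else 0) * (if j ≤ m 4 then (q₅.choose (m 4 - j) : ℤ) else 0) *
        ((p₂ + i).choose (m 0) : ℤ) * ((p₄ + j).choose (m 1) : ℤ) * ((e₁ + i + j).choose (m 2) : ℤ) := by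
  unfold termIJ
  have v1 : ∀ k : Fin 5, k ∉ (1 : P5).vars := fun k => by simp [vars_one]
  rw [coeff_X_pow_mul_X_add_pow_mul (3 : Fin 5) (v1 3) ?_]
  swap
  · repeat (first
      | exact v1 _
      | with_reducible exact (notMem_vars_X_and (by decide)).1
      | with_reducible apply notMem_vars_mul
      | with_reducible refine (notMem_vars_pow_and ?_ _).1
      | with_reducible apply notMem_vars_add)
  by_cases hi : i ≤ m 3
  · rw [if_pos hi, if_pos hi, one_pow, one_mul]
    rw [coeff_X_pow_mul_X_add_pow_mul (4 : Fin 5) (v1 4) ?_]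
    swap
    · repeat (first
        | exact v1 _
        | with_reducible exact (notMem_vars_X_and (by decide)).1
        | with_reducible apply notMem_vars_mul
        | with_reducible refine (notMem_vars_pow_and ?_ _).1
        | with_reducible apply notMem_vars_add)
    have e4 : (m.erase 3) 4 = m 4 := Finsupp.erase_ne (by decide)
    rw [e4]
    by_cases hj : j ≤ m 4
    · rw [if_pos hj, if_pos hj, one_pow, one_mul]
      rw [coeff_X_add_pow_mul (0 : Fin 5) (v1 0) ?_]
      swap
      · repeat (first
          | exact v1 _
          | with_reducible exact (notMem_vars_X_and (by decide)).1
          | with_reducible apply notMem_vars_mul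
          | with_reducible refine (notMem_vars_pow_and ?_ _).1
          | with_reducible apply notMem_vars_add)
      have e0 : ((m.erase 3).erase 4) 0 = m 0 := by simp
      rw [e0, one_pow, one_mul]
      rw [coeff_X_add_pow_mul (1 : Fin 5) (v1 1) ?_]
      swap
      · repeat (first
          | exact v1 _
          | with_reducible exact (notMem_vars_X_and (by decide)).1
          | with_reducible apply notMem_vars_mul
          | with_reducible refine (notMem_vars_pow_and ?_ _).1
          | with_reducible apply notMem_vars_add)
      have e1' : (((m.erase 3).erase 4).erase 0) 1 = m 1 := by simp
      rw [e1', one_pow, one_mul]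
      rw [show ((X 2 + 1) ^ (e₁ + i + j) : P5) = (X 2 + 1) ^ (e₁ + i + j) * 1 by rw [mul_one],
        coeff_X_add_pow_mul (2 : Fin 5) (v1 2) (v1 2)]
      have e2 : ((((m.erase 3).erase 4).erase 0).erase 1) 2 = m 2 := by simp
      have e3 : (((((m.erase 3).erase 4).erase 0).erase 1).erase 2) = 0 := by
        ext k; fin_cases k <;> simp
      rw [e2, e3, one_pow, one_mul, coeff_zero_one]
      ring
    · rw [if_neg hj, if_neg hj]; ring
  · rw [if_neg hi, if_neg hi]; ring

/-! ## The bridge -/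

/-- The value of `G` at admissible parameters with `t ≥ 0`, as an explicit double sum over `ℕ²`. -/
theorem G_eq_sum (p : Fin 7 → ℤ) (q : Fin 5 → ℤ) (ht : ∀ j, 0 ≤ tOfPQ p q j) :
    G (eOfPQ p q) (tOfPQ p q) = ∑ i ∈ range ((q 1).toNat + 1), ∑ j ∈ range ((q 3).toNat + 1),
      ((q 1).toNat.choose i * (q 3).toNat.choose j : ℤ) *
        ((if i ≤ (q 0 + p 1 - p 2).toNat then ((q 0).toNat.choose ((q 0 + p 1 - p 2).toNat - i) : ℤ) else 0) *
          (if j ≤ (q 4 + p 5 - p 4).toNat then ((q 4).toNat.choose ((q 4 + p 5 - p 4).toNat - j) : ℤ) else 0) *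
          (((p 2).toNat + i).choose (p 0).toNat : ℤ) * (((p 4).toNat + j).choose (p 6).toNat : ℤ) *
          (((q 2 - p 0 - p 6 + p 2 + p 4).toNat + i + j).choose (p 3 + q 2 - p 0 - p 6).toNat : ℤ)) := by
  unfold G coeffZ
  rw [if_pos ht, qPoly_eq_sum]
  simp only [coeff_sum, coeff_C_mul, coeff_termIJ, eOfPQ, tOfPQ, Finsupp.coe_equivFunOnFinite_symm,
    Matrix.cons_val_zero, Matrix.cons_val_one, Matrix.cons_val]
  refine Finset.sum_congr rfl fun i _ => Finset.sum_congr rfl fun j _ => ?_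
  push_cast
  ring

/-- **The bridge in twelve parameters**: `|Q(p;q)| = G(e(p,q), t(p,q))` for admissible `(p;q)`. -/
theorem abs_Qcoeff_eq_G (p : Fin 7 → ℤ) (q : Fin 5 → ℤ) (hp2 : 0 ≤ p 2) (hp4 : 0 ≤ p 4) (hq : ∀ j, 0 ≤ q j)
    (he1 : 0 ≤ q 2 - p 0 - p 6 + p 2 + p 4) : |Qcoeff p q| = G (eOfPQ p q) (tOfPQ p q) := by
  rw [abs_Qcoeff]
  by_cases ht : ∀ j, 0 ≤ tOfPQ p q j
  · -- both sides are the same double sum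
    have ht0 : 0 ≤ p 0 := by simpa [tOfPQ] using ht 0
    have ht1 : 0 ≤ p 6 := by simpa [tOfPQ] using ht 1
    have ht2 : 0 ≤ p 3 + q 2 - p 0 - p 6 := by simpa [tOfPQ] using ht 2
    have ht3 : 0 ≤ q 0 + p 1 - p 2 := by simpa [tOfPQ] using ht 3
    have ht4 : 0 ≤ q 4 + p 5 - p 4 := by simpa [tOfPQ] using ht 4
    rw [G_eq_sum p q ht]
    -- move the k₁-range to [p₂, p₂+q₂] and the k₂-range stays [p₄, p₄+q₄]
    have step1 : ∑ k₁ ∈ Icc (p 1) (p 1 + q 0), ∑ k₂ ∈ Icc (p 4) (p 4 + q 3), bzTerm p q k₁ k₂ =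
        ∑ k₁ ∈ Icc (p 2) (p 2 + q 1), ∑ k₂ ∈ Icc (p 4) (p 4 + q 3), bzTerm p q k₁ k₂ := by
      refine sum_eq_of_support (fun k₁ _ hk => ?_) (fun k₁ _ hk => ?_)
      · have hz : zchoose (q 1) (k₁ - p 2) = 0 := zchoose_eq_zero (by simp only [mem_Icc] at hk; omega)
        exact Finset.sum_eq_zero fun k₂ _ => by simp [bzTerm, hz]
      · have hz : zchoose (q 0) (k₁ - p 1) = 0 := zchoose_eq_zero (by simp only [mem_Icc] at hk; omega)
        exact Finset.sum_eq_zero fun k₂ _ => by simp [bzTerm, hz]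
    rw [step1]
    rw [show p 2 + q 1 = p 2 + ((q 1).toNat : ℕ) by have := hq 1; omega, sum_Icc_eq_sum_range]
    refine Finset.sum_congr rfl fun i hi => ?_
    rw [show p 4 + q 3 = p 4 + ((q 3).toNat : ℕ) by have := hq 3; omega, sum_Icc_eq_sum_range]
    refine Finset.sum_congr rfl fun j hj => ?_
    rw [mem_range] at hi hj
    unfold bzTerm
    -- the seven binomials, one by one
    have f1 : zchoose (p 2 + i) (p 0) = (((p 2).toNat + i).choose (p 0).toNat : ℤ) := by
      rw [zchoose_of_nonneg (by omega) ht0]; congr 2; omega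
    have f2 : zchoose (p 4 + j) (p 6) = (((p 4).toNat + j).choose (p 6).toNat : ℤ) := by
      rw [zchoose_of_nonneg (by omega) ht1]; congr 2; omega
    have f3 : zchoose (p 2 + i + (p 4 + j) + q 2 - p 0 - p 6) (p 3 + q 2 - p 0 - p 6) =
        (((q 2 - p 0 - p 6 + p 2 + p 4).toNat + i + j).choose (p 3 + q 2 - p 0 - p 6).toNat : ℤ) := by
      rw [zchoose_of_nonneg (by omega) ht2]; congr 2; omega
    have f4 : zchoose (q 0) (p 2 + i - p 1) =
        if i ≤ (q 0 + p 1 - p 2).toNat then ((q 0).toNat.choose ((q 0 + p 1 - p 2).toNat - i) : ℤ) else 0 :=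
      zchoose_flip (hq 0) rfl ht3 i
    have f5 : zchoose (q 1) (p 2 + i - p 2) = ((q 1).toNat.choose i : ℤ) := by
      rw [zchoose_of_nonneg (hq 1) (by omega)]; congr 2; omega
    have f6 : zchoose (q 3) (p 4 + j - p 4) = ((q 3).toNat.choose j : ℤ) := by
      rw [zchoose_of_nonneg (hq 3) (by omega)]; congr 2; omega
    have f7 : zchoose (q 4) (p 4 + j - p 5) =
        if j ≤ (q 4 + p 5 - p 4).toNat then ((q 4).toNat.choose ((q 4 + p 5 - p 4).toNat - j) : ℤ) else 0 :=
      zchoose_flip (hq 4) rfl ht4 j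
    rw [f1, f2, f3, f4, f5, f6, f7]
    ring
  · -- some `t_j < 0`: both sides vanish
    obtain ⟨j₀, hj₀⟩ : ∃ j, tOfPQ p q j < 0 := by
      by_contra hcon; push Not at hcon; exact ht hcon
    rw [G_eq_zero_of_neg _ _ j₀ hj₀]
    refine Finset.sum_eq_zero fun k₁ hk₁ => Finset.sum_eq_zero fun k₂ hk₂ => ?_
    rw [mem_Icc] at hk₁ hk₂
    unfold bzTerm
    fin_cases j₀
    · have h : zchoose k₁ (p 0) = 0 := zchoose_eq_zero (Or.inl (by simpa [tOfPQ] using hj₀))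
      simp [h]
    · have h : zchoose k₂ (p 6) = 0 := zchoose_eq_zero (Or.inl (by simpa [tOfPQ] using hj₀))
      simp [h]
    · have h : zchoose (k₁ + k₂ + q 2 - p 0 - p 6) (p 3 + q 2 - p 0 - p 6) = 0 :=
        zchoose_eq_zero (Or.inl (by simpa [tOfPQ] using hj₀))
      simp [h]
    · have h' : q 0 + p 1 - p 2 < 0 := by simpa [tOfPQ] using hj₀
      have h : zchoose (q 1) (k₁ - p 2) = 0 := zchoose_eq_zero (Or.inl (by omega))
      simp [h]
    · have h' : q 4 + p 5 - p 4 < 0 := by simpa [tOfPQ] using hj₀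
      have h : zchoose (q 4) (k₂ - p 5) = 0 := zchoose_eq_zero (Or.inr (by have := hq 4; omega))
      simp [h]

/-! ## On Brown–Zudilin's cone -/

/-- `e(a) = (a₃+a₆+2a₇−a₁−a₂−a₅, a₅, a₆, a₃, a₁, a₄, a₀)` (0-based `a`; the first entry is `b₁₄ + a₈ ≥ 0` on the cone). -/
def eOfA (a : Fin 8 → ℤ) : Fin 7 → ℕ :=
  ![(a 3 + a 6 + 2 * a 7 - a 1 - a 2 - a 5).toNat, (a 5).toNat, (a 6).toNat, (a 3).toNat, (a 1).toNat, (a 4).toNat,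
    (a 0).toNat]

/-- `t(a) = (a₄+a₅−a₇, a₀+a₁+a₅−a₃−a₇, a₃−a₅+a₇, a₁+a₂−a₇, a₁+a₂+a₅−a₆−a₇) = (B₇, B₃, b₆(a), B₅, B₁)`. -/
def tOfA (a : Fin 8 → ℤ) : Fin 5 → ℤ :=
  ![a 4 + a 5 - a 7, a 0 + a 1 + a 5 - a 3 - a 7, a 3 - a 5 + a 7, a 1 + a 2 - a 7, a 1 + a 2 + a 5 - a 6 - a 7]

/-- **The bridge on the cone**: `|Q(a)| = G(e(a), t(a))` whenever `bzNum a ≥ 0` and Brown–Zudilin's convergence form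
`h₂₇(a) = a₃+a₆+2a₇−a₁−a₂−a₅` (0-based; `= e₁(a)`, the exponent of `1+v`) is `≥ 0` — automatic on the convergent cone
(`27 ∈ F`), but NOT implied by `bzNum, bzDen ≥ 0` alone (e.g. `a = (0,1,1,0,2,0,1,0)` has `h₂₇ = −1`; there `|Q| = 1` is the
`v⁰`-coefficient of a POWER SERIES `(1+v)^{−1}⋯`, outside the polynomial family `G`). -/
theorem abs_QOf_eq_G (a : Fin 8 → ℤ) (hA : ∀ i, 0 ≤ bzNum a i)
    (h27 : 0 ≤ a 3 + a 6 + 2 * a 7 - a 1 - a 2 - a 5) : |QOf a| = G (eOfA a) (tOfA a) := by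
  have a0 := hA 0; have a1 := hA 1; have a3 := hA 3; have a4 := hA 4; have a5 := hA 5; have a6 := hA 6
  have a7 := hA 7
  simp [bzNum] at a0 a1 a3 a4 a5 a6 a7
  have hp2 : 0 ≤ pOf a 2 := by simp [pOf]; omega
  have hp4 : 0 ≤ pOf a 4 := by simp [pOf]; omega
  have hq : ∀ j, 0 ≤ qOf a j := by intro j; fin_cases j <;> simp [qOf] <;> omega
  have he1 : 0 ≤ qOf a 2 - pOf a 0 - pOf a 6 + pOf a 2 + pOf a 4 := by simp [pOf, qOf]; omega
  have he : eOfPQ (pOf a) (qOf a) = eOfA a := by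
    funext k; fin_cases k <;> simp [eOfPQ, eOfA, pOf, qOf]; omega
  have ht : tOfPQ (pOf a) (qOf a) = tOfA a := by
    funext k; fin_cases k <;> simp [tOfPQ, tOfA, pOf, qOf] <;> ring
  unfold QOf
  rw [abs_Qcoeff_eq_G _ _ hp2 hp4 hq he1, he, ht]

end DualQ

end Summit.KontsevichZagierPeriods.Zeta5Search.Families.Cellular
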